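import Literature.AlgebraicTopology.Homotopy.SimplexPrismExtension
import Literature.AlgebraicTopology.SingularHomology.StdSimplexHorn
import HarnessLib

/-!
# Normalising a map of pairs `(Δ^{q+1}, ∂Δ^{q+1}) → (X, A)` to be constant on a horn

Topic `Literature/AlgebraicTopology/Homotopy`. In the model of the relative homotopy groups by
maps of triples `(Iⁿ, ∂Iⁿ, Jⁿ⁻¹) → (X, A, x₀)` (Hatcher, *Algebraic Topology* (2002), §4.1,
p. 343; the tree's `RelGenLoop`, `RelativeHomotopyGroups.lean`) an arbitrary map of PAIRS
`(Dⁿ, Sⁿ⁻¹) → (X, A)` does not directly represent an element of `πₙ(X, A, x₀)`: it first has to be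
deformed, through maps of pairs, into a map sending `Jⁿ⁻¹` to a point. (In Spanier's model
`(Eⁿ, Sⁿ⁻¹, p₀)`, *Algebraic Topology* (1966), Ch. 7 §2, this step is invisible — every map of
pairs is a map of triples with `x₀ = α(p₀)` — which is how Cor. 7.2.2, "`(X, A)` is `n`-connected
iff … `π_k(X, A, a) = 0`", follows at once from Thm. 7.2.1 there; Hatcher p. 351 remarks that
"`Jⁿ⁻¹` [can be] collapsed to a point" since it is contractible.) This file performs that step
on the standard simplex, with the horn `Λ₀ = stdHorn 0` (all facets but the `0`-th; the image of
`J` under the cone map of `SimplexConeMap.lean`) in the role of `Jⁿ⁻¹`, everything PROVED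
(`[folklore]`):

* `HornNormalize.toVertex`, `HornNormalize.hornContr : C(Δ^{q+1} × I, Δ^{q+1})` — the straight
  segment to the vertex `v₀` followed by the retraction `hornRetr 0` onto the horn
  (`StdSimplexHorn.lean`): a contraction of the horn *within the horn* to the vertex `v₀`
  (`hornContr_zero_of_mem`, `hornContr_one`, `hornContr_mem_stdHorn`);
* `HornNormalize.exists_faceZero_fill` — the free facet `δ₀(Δ^q)` carries a homotopy *inside `A`*
  starting at `g ∘ δ₀` and equal to `g ∘ hornContr` on its boundary (homotopy extension over the
  facet, `SimplexPrism.exists_fill` applied in the subspace `A`);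
* **`HornNormalize.exists_horn_normalization`** — for `g : Δ^{q+1} → X` with `g(∂Δ^{q+1}) ⊆ A`
  there is a homotopy `P` of maps of pairs (`P(∂Δ^{q+1} × I) ⊆ A`) from `g` to a map which is
  constant `= g(v₀)` on the horn `Λ₀` (homotopy extension over `Δ^{q+1}` of the data
  "`g ∘ hornContr` on the horn, the facet homotopy on `δ₀(Δ^q)`", again by
  `SimplexPrism.exists_fill`).

Combined with `SimplexCone.exists_homotopy_const_of_subsingleton` (`SimplexConeMap.lean`) and
`PrismTop.exists_homotopy_rel_of_pair_homotopy` (`PrismTopRetraction.lean`) this gives the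
compression lemma "`π_{q+1}(X, A, a) = 0` for all `a` ⟹ every map `(Δ^{q+1}, ∂Δ^{q+1}) → (X, A)`
is homotopic rel `∂Δ^{q+1}` into `A`" (`RelativeCompression.lean`).

## References

* A. Hatcher, *Algebraic Topology*, CUP (2002), §4.1, pp. 343, 351; Prop. 0.16 (homotopy
  extension for `(Dⁿ, Sⁿ⁻¹)`). [HatcherAT2002]
* E. H. Spanier, *Algebraic Topology*, McGraw-Hill 1966 / Springer 1981, Ch. 7 §2, Thm. 1 and
  Cor. 2. [Spanier1981]
-/

noncomputable section

open Set Function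
open scoped unitInterval

namespace Literature.AlgebraicTopology.Homotopy

namespace HornNormalize

open Literature.AlgebraicTopology.SingularHomology

variable {q : ℕ}

/-! ### Contracting the horn within itself -/

variable (q) in
/-- The vertex `v₀ = (1, 0, …, 0)` of `Δ^{q+1}`, opposite to the `0`-th facet; it lies on every
other facet, hence in the horn `Λ₀`. [folklore] -/
abbrev v₀ : StdSimplex (q + 1) := stdSimplex.vertex (S := ℝ) (0 : Fin (q + 2))

/-- The coordinates of `v₀` of positive index vanish. [folklore] -/
lemma v₀_apply_succ (l : Fin (q + 1)) : v₀ q l.succ = 0 := by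
  simp [stdSimplex.vertex_coe]

/-- `v₀` lies in the horn `Λ₀`. [folklore] -/
lemma v₀_mem_stdHorn : v₀ q ∈ stdHorn (n := q) 0 :=
  ⟨(0 : Fin (q + 1)).succ, Fin.succ_ne_zero _, v₀_apply_succ 0⟩

/-- `v₀` lies on the boundary. [folklore] -/
lemma v₀_mem_stdBoundary : v₀ q ∈ stdBoundary (q + 1) :=
  stdHorn_subset_stdBoundary _ v₀_mem_stdHorn

/-- The point `(1 - s) t + s v₀` of the segment from `t` to the vertex `v₀` (inside the convex
simplex). [folklore] -/
def toVertex : C(StdSimplex (q + 1) × I, StdSimplex (q + 1)) where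
  toFun p := ⟨(1 - (p.2 : ℝ)) • (p.1 : Fin (q + 2) → ℝ) + (p.2 : ℝ) • (v₀ q : Fin (q + 2) → ℝ),
    convex_stdSimplex ℝ (Fin (q + 2)) p.1.2 (v₀ q).2 (unitInterval.one_minus_nonneg _)
      (unitInterval.nonneg _) (by ring)⟩
  continuous_toFun := by
    refine Continuous.subtype_mk ?_ _
    exact ((continuous_const.sub (continuous_subtype_val.comp continuous_snd)).smul
      (continuous_subtype_val.comp continuous_fst)).add
      ((continuous_subtype_val.comp continuous_snd).smul continuous_const)

/-- Coordinates of `toVertex`. [folklore] -/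
lemma toVertex_apply (t : StdSimplex (q + 1)) (s : I) (i : Fin (q + 2)) :
    toVertex (t, s) i = (1 - (s : ℝ)) * t i + (s : ℝ) * v₀ q i := rfl

/-- At time `0` the segment is at `t`. [folklore] -/
@[simp]
lemma toVertex_zero (t : StdSimplex (q + 1)) : toVertex (t, 0) = t := by
  ext i; rw [toVertex_apply]; simp

/-- At time `1` the segment is at `v₀`. [folklore] -/
@[simp]
lemma toVertex_one (t : StdSimplex (q + 1)) : toVertex (t, 1) = v₀ q := by
  ext i; rw [toVertex_apply]; simp

/-- **The contraction of the horn**: `hornContr (t, s) = r₀((1 - s) t + s v₀)`, `r₀ = hornRetr 0`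
the retraction of `Δ^{q+1}` onto `Λ₀`. It takes values in the horn, is the identity on the horn
at time `0` and constant `= v₀` at time `1`: the horn is contractible within itself (Hatcher 2002,
p. 351: `Jⁿ⁻¹` is contractible). [folklore] -/
def hornContr : C(StdSimplex (q + 1) × I, StdSimplex (q + 1)) :=
  (hornRetr (n := q) 0).comp toVertex

/-- Unfolding of `hornContr`. [folklore] -/
lemma hornContr_apply (p : StdSimplex (q + 1) × I) : hornContr p = hornRetr 0 (toVertex p) := rfl

/-- `hornContr` takes values in the horn. [folklore] -/
lemma hornContr_mem_stdHorn (p : StdSimplex (q + 1) × I) : hornContr p ∈ stdHorn (n := q) 0 :=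
  hornRetr_mem_stdHorn _ _

/-- `hornContr` takes values in the boundary. [folklore] -/
lemma hornContr_mem_stdBoundary (p : StdSimplex (q + 1) × I) : hornContr p ∈ stdBoundary (q + 1) :=
  stdHorn_subset_stdBoundary _ (hornContr_mem_stdHorn p)

/-- At time `0`, `hornContr` is the retraction `r₀`. [folklore] -/
lemma hornContr_zero (t : StdSimplex (q + 1)) : hornContr (t, 0) = hornRetr 0 t := by
  rw [hornContr_apply, toVertex_zero]

/-- At time `0`, `hornContr` is the identity on the horn. [folklore] -/
lemma hornContr_zero_of_mem {t : StdSimplex (q + 1)} (ht : t ∈ stdHorn (n := q) 0) :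
    hornContr (t, 0) = t := by
  rw [hornContr_zero, hornRetr_eq_self ht]

/-- At time `1`, `hornContr` is constant `= v₀`. [folklore] -/
@[simp]
lemma hornContr_one (t : StdSimplex (q + 1)) : hornContr (t, 1) = v₀ q := by
  rw [hornContr_apply, toVertex_one, hornRetr_eq_self v₀_mem_stdHorn]

/-- A boundary point of `Δ^q` pushed into the `0`-th facet lies in the horn `Λ₀` (it has a second
vanishing coordinate). [folklore] -/
lemma stdFace_zero_mem_stdHorn {w : StdSimplex q} (hw : w ∈ stdBoundary q) :
    stdFace 0 w ∈ stdHorn (n := q) 0 := by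
  obtain ⟨l, hl⟩ := hw
  refine ⟨l.succ, Fin.succ_ne_zero _, ?_⟩
  rw [← Fin.succAbove_zero, stdFace_apply_succAbove]
  exact hl

/-- A point of the `0`-th facet with a vanishing coordinate of positive index comes from a
boundary point of `Δ^q`. [folklore] -/
lemma mem_stdBoundary_of_stdFace_zero_apply_succ {w : StdSimplex q} {l : Fin (q + 1)}
    (h : stdFace (0 : Fin (q + 2)) w l.succ = 0) : w ∈ stdBoundary q :=
  ⟨l, by rwa [← Fin.succAbove_zero, stdFace_apply_succAbove] at h⟩

/-! ### The homotopy on the free facet, inside `A` -/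

variable {X : Type*} [TopologicalSpace X] {A : Set X}

/-- **The free facet carries a homotopy inside `A`** starting at `g ∘ δ₀` and equal to
`g ∘ hornContr ∘ (δ₀ × 1)` over the boundary `∂Δ^q` of the facet (where `δ₀` lands in the horn,
on which `g ∘ hornContr` makes sense as a homotopy in `A`): homotopy extension over the facet
`(Δ^q, ∂Δ^q)`, performed in the subspace `A` (`SimplexPrism.exists_fill`; for `q = 0` the facet is
a point and the constant homotopy will do). [folklore] -/
theorem exists_faceZero_fill (g : C(StdSimplex (q + 1), X))
    (hg : ∀ t ∈ stdBoundary (q + 1), g t ∈ A) :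
    ∃ E : C(StdSimplex q × I, X), (∀ w, E (w, 0) = g (stdFace 0 w)) ∧ (∀ w s, E (w, s) ∈ A) ∧
      ∀ w ∈ stdBoundary q, ∀ s, E (w, s) = g (hornContr (stdFace 0 w, s)) := by
  cases q with
  | zero =>
    -- the facet is a point: take the constant homotopy
    refine ⟨⟨fun p => g (stdFace 0 p.1), g.continuous.comp ((stdFace 0).continuous.comp
      continuous_fst)⟩, fun w => rfl, fun w s => hg _ (stdFace_mem_stdBoundary 0 w), ?_⟩
    intro w hw
    rw [stdBoundary_zero] at hw
    exact absurd hw (Set.notMem_empty w)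
  | succ q =>
    -- homotopy extension over `Δ^{q+1}` in the space `A`
    let e : C(StdSimplex (q + 1), A) :=
      ⟨fun w => ⟨g (stdFace 0 w), hg _ (stdFace_mem_stdBoundary 0 w)⟩,
        (g.continuous.comp (stdFace 0).continuous).subtype_mk _⟩
    let Es : Fin (q + 2) → C(StdSimplex q × I, A) := fun l =>
      ⟨fun p => ⟨g (hornContr (stdFace 0 (stdFace l p.1), p.2)), hg _ (hornContr_mem_stdBoundary _)⟩,
        (g.continuous.comp (hornContr.continuous.comp
          (((stdFace 0).continuous.comp ((stdFace l).continuous.comp continuous_fst)).prodMk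
            continuous_snd))).subtype_mk _⟩
    have hEs : SimplexPrism.Compatible Es := by
      intro l l' u u' s h
      apply Subtype.ext
      show g (hornContr (stdFace 0 (stdFace l u), s)) = g (hornContr (stdFace 0 (stdFace l' u'), s))
      rw [h]
    have hbot : ∀ l u, Es l (u, 0) = e (stdFace l u) := by
      intro l u
      apply Subtype.ext
      show g (hornContr (stdFace 0 (stdFace l u), 0)) = g (stdFace 0 (stdFace l u))
      rw [hornContr_zero_of_mem (stdFace_zero_mem_stdHorn (stdFace_mem_stdBoundary l u))]
    obtain ⟨G, hG0, hGs⟩ := SimplexPrism.exists_fill e Es hEs hbot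
    refine ⟨⟨fun p => (G p : X), continuous_subtype_val.comp G.continuous⟩,
      fun w => congrArg Subtype.val (hG0 w), fun w s => (G (w, s)).2, fun w hw s => ?_⟩
    obtain ⟨l, hl⟩ := hw
    obtain ⟨u, rfl⟩ := exists_stdFace_eq l w hl
    exact congrArg Subtype.val (hGs l u s)

/-! ### The normalisation -/

/-- The side data for the homotopy extension over `Δ^{q+1}`: on the `0`-th facet the homotopy `E`
inside `A`, on the facets of the horn `g ∘ hornContr`. [folklore] -/
def sides (g : C(StdSimplex (q + 1), X)) (E : C(StdSimplex q × I, X)) (i : Fin (q + 2)) :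
    C(StdSimplex q × I, X) :=
  if i = 0 then E
  else g.comp (hornContr.comp ⟨fun p => (stdFace i p.1, p.2),
    ((stdFace i).continuous.comp continuous_fst).prodMk continuous_snd⟩)

/-- The side data on the `0`-th facet. [folklore] -/
lemma sides_zero (g : C(StdSimplex (q + 1), X)) (E : C(StdSimplex q × I, X)) : sides g E 0 = E :=
  if_pos rfl

/-- The side data on a facet of the horn. [folklore] -/
lemma sides_apply_of_ne_zero (g : C(StdSimplex (q + 1), X)) (E : C(StdSimplex q × I, X))
    {i : Fin (q + 2)} (hi : i ≠ 0) (w : StdSimplex q) (s : I) :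
    sides g E i (w, s) = g (hornContr (stdFace i w, s)) := by
  rw [sides, if_neg hi]; rfl

/-- **Normalisation on the horn.** For `g : Δ^{q+1} → X` with `g(∂Δ^{q+1}) ⊆ A` there is a
homotopy `P : Δ^{q+1} × I → X` of maps of pairs — `P(·, 0) = g`, `P(∂Δ^{q+1} × I) ⊆ A` — ending
at a map which is constant `= g(v₀)` on the horn `Λ₀` (and so, read through the cone map of
`SimplexConeMap.lean`, is a relative loop `(I^{q+1}, ∂I^{q+1}, J^q) → (X, A, g v₀)`). Construction:
contract the horn within itself (`hornContr`), extend over the free facet inside `A`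
(`exists_faceZero_fill`), and extend the resulting boundary homotopy over the simplex
(`SimplexPrism.exists_fill`, Hatcher 2002, Prop. 0.16). This is the reduction of "every map of
pairs compresses" to "`π_{q+1}(X, A, a) = 0`" implicit in Spanier 1966, Cor. 7.2.2 / Hatcher 2002,
p. 346 (equivalence of the three forms of `n`-connectedness). [folklore] -/
theorem exists_horn_normalization (g : C(StdSimplex (q + 1), X))
    (hg : ∀ t ∈ stdBoundary (q + 1), g t ∈ A) :
    ∃ P : C(StdSimplex (q + 1) × I, X), (∀ t, P (t, 0) = g t) ∧
      (∀ t ∈ stdBoundary (q + 1), ∀ s, P (t, s) ∈ A) ∧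
      ∀ t ∈ stdHorn (n := q) 0, P (t, 1) = g (v₀ q) := by
  obtain ⟨E, hE0, hEA, hEb⟩ := exists_faceZero_fill g hg
  have hF : SimplexPrism.Compatible (sides g E) := by
    intro i j w w' s h
    by_cases hi : i = 0 <;> by_cases hj : j = 0
    · subst hi; subst hj
      rw [stdFace_injective 0 h]
    · subst hi
      -- `δ₀ w = δⱼ w'` lies in the horn, so `w ∈ ∂Δ^q` and `E = g ∘ hornContr` there
      have hw : w ∈ stdBoundary q := by
        obtain ⟨l, rfl⟩ := Fin.exists_succ_eq.2 hj
        exact mem_stdBoundary_of_stdFace_zero_apply_succ (by rw [h]; exact stdFace_apply_self _ _)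
      rw [sides_zero, sides_apply_of_ne_zero g E hj, hEb w hw s, h]
    · subst hj
      have hw' : w' ∈ stdBoundary q := by
        obtain ⟨l, rfl⟩ := Fin.exists_succ_eq.2 hi
        exact mem_stdBoundary_of_stdFace_zero_apply_succ (by rw [← h]; exact stdFace_apply_self _ _)
      rw [sides_zero, sides_apply_of_ne_zero g E hi, hEb w' hw' s, h]
    · rw [sides_apply_of_ne_zero g E hi, sides_apply_of_ne_zero g E hj, h]
  have hbot : ∀ i w, sides g E i (w, 0) = g (stdFace i w) := by
    intro i w
    by_cases hi : i = 0
    · subst hi; rw [sides_zero, hE0]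
    · rw [sides_apply_of_ne_zero g E hi, hornContr_zero_of_mem (stdFace_mem_stdHorn hi w)]
  obtain ⟨P, hP0, hPs⟩ := SimplexPrism.exists_fill g (sides g E) hF hbot
  refine ⟨P, hP0, fun t ht s => ?_, fun t ht => ?_⟩
  · obtain ⟨i, hi⟩ := ht
    obtain ⟨w, rfl⟩ := exists_stdFace_eq i t hi
    rw [hPs]
    by_cases hi0 : i = 0
    · subst hi0; rw [sides_zero]; exact hEA w s
    · rw [sides_apply_of_ne_zero g E hi0]
      exact hg _ (hornContr_mem_stdBoundary _)
  · obtain ⟨i, hi0, hi⟩ := ht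
    obtain ⟨w, rfl⟩ := exists_stdFace_eq i t hi
    rw [hPs, sides_apply_of_ne_zero g E hi0, hornContr_one]

/-- The value `g(v₀)` at which the normalised map is constant on the horn lies in `A`. [folklore] -/
lemma apply_v₀_mem (g : C(StdSimplex (q + 1), X)) (hg : ∀ t ∈ stdBoundary (q + 1), g t ∈ A) :
    g (v₀ q) ∈ A :=
  hg _ v₀_mem_stdBoundary

end HornNormalize

end Literature.AlgebraicTopology.Homotopy

end
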